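import Literature.NumberTheory.CubicFields.HasseUnramifiedResolvent
import Literature.NumberTheory.NumberFields.UnramifiedViaInertia
import Literature.NumberTheory.NumberFields.InertiaGeneratesGalois
import HarnessLib

/-!
# The quadratic subfield of an abelian sextic field of discriminant `−27p⁴` is `ℚ(√−3)`

Topic `Summits/QuantumAdvantage/QuantumAdvantage/Theorems`; helper for the crux `SexticEscapeCount`
(stmt-QuantumAdvantage-14545) of route `ThirdFactorialPincer` (cell B2b-1 toolkit, linnik-cubic).
HONEST FRAMING: the value of this file is a THEOREM (kernel-checked, standard axioms) — not summit
progress.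

`discr_quadratic_eq_neg_three` — **let `L/ℚ` be an abelian (Galois, commutative Galois group)
number field of degree `6` with `d_L = −27p⁴`, `p ≥ 5` prime, and `K ⊆ L` a quadratic subfield;
then `d_K = −3`.**  This is the algebraic identification left open by
`ThirdFactorialPincerSexticEscapeCountOfQuadraticSubfield.lean` (the crux `SexticEscapeCount` from
"every quadratic subfield of the abelian sextic field of discriminant `−27p⁴` has discriminant
`−3`"); with it the crux closes (`ThirdFactorialPincerSexticEscapeCount.lean`).

## Proof (inertia groups in `G = Gal(L/ℚ)`, `#G = 6`, `H_K = Gal(L/K)` of order `3`)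

For a maximal `Q ⊆ 𝓞 L`, the prime `Q ∩ K` of `K` is unramified over `ℤ` iff `I(Q) ≤ H_K`
(`isUnramifiedAt_under_iff_inertia_le`, Serre I §7 Prop. 22); an `I(Q)` of order `3` lies in the
index-`2` subgroup `H_K` (squares lie in `H_K`), so `Q ∩ K` ramified forces `#I(Q) ∈ {2, 6}`.
* `p ∤ d_K`: otherwise take `Q ∣ p`; `Q ∩ K` is ramified (`K/ℚ` is Galois and `p ∣ d_K`). If
  `#I(Q) = 6` then `e(Q|p) = 6` and `p⁵ ∣ d_L = −27p⁴` (`pow_ramificationIdx_sub_one_dvd_discr`),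
  impossible. If `#I(Q) = 2`, the fixed field `F'` of the normal (abelian!) subgroup `I(Q)` is a
  Galois cubic field in which `p` is unramified (`I(Q) ≤ H_{F'} = I(Q)`), so `p ∤ d_{F'}`; since
  `H_{F'} ∩ H_K = 1`, `|d_L| ∣ |d_{F'}|² |d_K|³` (`natAbs_discr_dvd_prod_pow_of_isGalois`, Serre IV §1
  Prop. 4), whence `p⁴ ∣ |d_K|³` — impossible as `p² ∤ d_K` (`d_K` fundamental, `p` odd).
* every prime `ℓ ∣ d_K` divides `d_L` (a `Q ∣ ℓ` has `Q ∩ K` ramified, so `I(Q) ≠ 1`, so `Q` is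
  ramified over `ℤ`; Dedekind's discriminant theorem, Mathlib `not_dvd_discr_iff_forall_mem`), so
  the prime divisors of `d_K` lie in `{3, p} ∖ {p} = {3}`;
* `d_K` is a fundamental discriminant (`Quadratic.isFundamentalDiscriminant_discr`): it is odd
  (else `2 ∣ d_L = −27p⁴`), hence squarefree and `≡ 1 (mod 4)`, so `d_K ∈ {−3, 3, −1, 1}` and
  `d_K = −3`.
-/

noncomputable section

-- the `Algebra ℚ ↥K` diamond (`IntermediateField.algebra` vs `DivisionRing.toRatAlgebra`) is only
-- defeq at default transparency (as in `HasseUnramifiedResolvent.lean`).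
set_option backward.isDefEq.respectTransparency false

open NumberField Ideal Module IntermediateField
open scoped Pointwise

namespace Summit.QuantumAdvantage.QuantumAdvantage.Theorems.SexticEscapeCount

open Literature.NumberTheory.NumberFields Literature.NumberTheory.QuadraticFields
  Literature.NumberTheory.CubicFields Literature.NumberTheory.GaloisRepresentations

/-! ### Group-theoretic preliminaries -/

/-- An element of order dividing `3` lies in every subgroup of index `2` (`x = (x·x)·(x·x)` and
squares lie in an index-`2` subgroup). [folklore] -/
theorem mem_of_index_two_of_pow_three {G : Type*} [Group G] {H : Subgroup G} (hH : H.index = 2)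
    {x : G} (hx : x ^ 3 = 1) : x ∈ H := by
  have h4 : x = (x * x) * (x * x) := by
    calc x = x ^ 3 * x := by rw [hx, one_mul]
      _ = (x * x) * (x * x) := by simp only [pow_succ, pow_zero, one_mul, mul_assoc]
  rw [h4]
  exact H.mul_mem (Subgroup.mul_self_mem_of_index_two hH x) (Subgroup.mul_self_mem_of_index_two hH x)

/-- A subgroup of order `3` is contained in every subgroup of index `2`. [folklore] -/
theorem le_of_card_eq_three_of_index_two {G : Type*} [Group G] {H I : Subgroup G}
    (hH : H.index = 2) (hI : Nat.card I = 3) : I ≤ H := by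
  intro x hx
  refine mem_of_index_two_of_pow_three hH ?_
  have h := Subgroup.orderOf_dvd_natCard I hx
  rw [hI] at h
  exact orderOf_dvd_iff_pow_eq_one.mp h

/-- An element lying in a subgroup of order `2` and in a subgroup of order `3` is trivial.
[folklore] -/
theorem eq_one_of_mem_of_card_two_three {G : Type*} [Group G] {A B : Subgroup G}
    (hA : Nat.card A = 2) (hB : Nat.card B = 3) {x : G} (hxA : x ∈ A) (hxB : x ∈ B) : x = 1 := by
  have h2 : orderOf x ∣ 2 := hA ▸ Subgroup.orderOf_dvd_natCard A hxA
  have h3 : orderOf x ∣ 3 := hB ▸ Subgroup.orderOf_dvd_natCard B hxB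
  have h1 : orderOf x ∣ Nat.gcd 2 3 := Nat.dvd_gcd h2 h3
  have : orderOf x = 1 := by simpa using h1
  exact orderOf_eq_one_iff.mp this

/-! ### Arithmetic preliminaries -/

/-- A prime `q` dividing `27·p⁴` (`p` prime) is `3` or `p`. [folklore] -/
theorem eq_three_or_eq_of_prime_dvd {p q : ℕ} (hp : p.Prime) (hq : q.Prime)
    (h : q ∣ 27 * p ^ 4) : q = 3 ∨ q = p := by
  rcases (Nat.Prime.dvd_mul hq).mp h with h27 | hp4
  · left
    have : q ∣ 3 ^ 3 := by norm_num; exact h27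
    exact (Nat.prime_dvd_prime_iff_eq hq Nat.prime_three).mp (hq.dvd_of_dvd_pow this)
  · right
    exact (Nat.prime_dvd_prime_iff_eq hq hp).mp (hq.dvd_of_dvd_pow hp4)

/-- If `p ∣ d`, `p² ∤ d` (in `ℤ`, `p` prime) and `p ∤ a`, then `p⁴ ∤ a² · |d|³`. [folklore] -/
theorem not_pow_four_dvd {p : ℕ} (hp : p.Prime) {a : ℕ} {d : ℤ} (ha : ¬ p ∣ a)
    (hd2 : ¬ (p : ℤ) ^ 2 ∣ d) : ¬ p ^ 4 ∣ a ^ 2 * d.natAbs ^ 3 := by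
  intro h
  have hcop : Nat.Coprime (p ^ 4) (a ^ 2) :=
    Nat.Coprime.pow _ _ ((Nat.Prime.coprime_iff_not_dvd hp).mpr ha)
  have h3 : p ^ 4 ∣ d.natAbs ^ 3 := hcop.dvd_of_dvd_mul_left h
  -- `v_p(|d|) ≤ 1`, so `v_p(|d|³) ≤ 3`
  have hd2' : ¬ p ^ 2 ∣ d.natAbs := by
    intro h'
    apply hd2
    have : ((p ^ 2 : ℕ) : ℤ) ∣ d := Int.ofNat_dvd_left.mpr h'
    exact_mod_cast this
  have hd0 : d.natAbs ≠ 0 := by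
    intro h0
    apply hd2'
    rw [h0]; exact dvd_zero _
  have hv : d.natAbs.factorization p ≤ 1 := by
    by_contra hlt
    push Not at hlt
    exact hd2' ((hp.pow_dvd_iff_le_factorization hd0).mpr hlt)
  have hv3 : (d.natAbs ^ 3).factorization p ≤ 3 := by
    rw [Nat.factorization_pow]
    simp only [Finsupp.smul_apply, smul_eq_mul]
    omega
  have h4 : 4 ≤ (d.natAbs ^ 3).factorization p :=
    (hp.pow_dvd_iff_le_factorization (pow_ne_zero 3 hd0)).mp h3
  omega

/-! ### The identification -/

section Main

variable {L : Type*} [Field L] [NumberField L] [IsGalois ℚ L]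

/-- **Inertia groups at primes where the quadratic subfield ramifies.**  Let `L/ℚ` be a Galois
sextic, `K ⊆ L` quadratic (`#H_K = 3`), `Q ⊆ 𝓞 L` maximal with `Q ∩ K` ramified over `ℤ`.  Then
`#I(Q) ∈ {2, 6}`: `I(Q) ≰ H_K` (`isUnramifiedAt_under_iff_inertia_le`), and a subgroup of order
`1` or `3` lies in the index-`2` subgroup `H_K`. [folklore] -/
theorem card_inertia_of_ramified_quadratic (hL : finrank ℚ L = 6) (K : IntermediateField ℚ L)
    (hK : finrank ℚ K = 2) (Q : Ideal (𝓞 L)) [Q.IsMaximal]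
    (hram : ¬ Algebra.IsUnramifiedAt ℤ (Q.under (𝓞 K))) :
    Nat.card (Q.inertia (L ≃ₐ[ℚ] L)) = 2 ∨ Nat.card (Q.inertia (L ≃ₐ[ℚ] L)) = 6 := by
  classical
  rw [isUnramifiedAt_under_iff_inertia_le L K Q] at hram
  set I : Subgroup (L ≃ₐ[ℚ] L) := Q.inertia (L ≃ₐ[ℚ] L) with hIdef
  have hG : Nat.card (L ≃ₐ[ℚ] L) = 6 := by rw [IsGalois.card_aut_eq_finrank, hL]
  have hKL : finrank K L = 3 := by
    have h := Module.finrank_mul_finrank ℚ K L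
    rw [hK, hL] at h
    omega
  have hHK : Nat.card K.fixingSubgroup = 3 := by rw [IsGalois.card_fixingSubgroup_eq_finrank, hKL]
  have hidx : K.fixingSubgroup.index = 2 := by
    have h := Subgroup.card_mul_index K.fixingSubgroup
    rw [hHK, hG] at h
    omega
  have hI6 : Nat.card I ∣ 6 := hG ▸ Subgroup.card_subgroup_dvd_card I
  have hpos : 0 < Nat.card I := Nat.card_pos
  have hle : Nat.card I ≤ 6 := Nat.le_of_dvd (by norm_num) hI6
  have hcases : Nat.card I = 1 ∨ Nat.card I = 2 ∨ Nat.card I = 3 ∨ Nat.card I = 6 := by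
    interval_cases h : Nat.card I <;> omega
  rcases hcases with h1 | h2 | h3 | h6
  · exfalso
    apply hram
    rw [Subgroup.eq_bot_of_card_eq I h1]
    exact bot_le
  · exact Or.inl h2
  · exact absurd (le_of_card_eq_three_of_index_two hidx h3) hram
  · exact Or.inr h6

/-- A quadratic subfield of a Galois field is Galois over `ℚ` (its fixing subgroup has index `2`).
[folklore] -/
theorem isGalois_of_quadratic (hL : finrank ℚ L = 6) (K : IntermediateField ℚ L)
    (hK : finrank ℚ K = 2) : IsGalois ℚ K := by
  have hG : Nat.card (L ≃ₐ[ℚ] L) = 6 := by rw [IsGalois.card_aut_eq_finrank, hL]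
  have hKL : finrank K L = 3 := by
    have h := Module.finrank_mul_finrank ℚ K L
    rw [hK, hL] at h
    omega
  have hHK : Nat.card K.fixingSubgroup = 3 := by rw [IsGalois.card_fixingSubgroup_eq_finrank, hKL]
  haveI : K.fixingSubgroup.Normal := by
    refine Subgroup.normal_of_index_eq_two ?_
    have h := Subgroup.card_mul_index K.fixingSubgroup
    rw [hHK, hG] at h
    omega
  have hfix : IntermediateField.fixedField K.fixingSubgroup = K := IsGalois.fixedField_fixingSubgroup K
  haveI := IsGalois.of_fixedField_normal_subgroup (K := ℚ) (L := L) K.fixingSubgroup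
  exact IsGalois.of_algEquiv (IntermediateField.equivOfEq hfix)

/-- For a rational prime `ℓ` dividing the discriminant of the quadratic subfield `K` and a maximal
`Q ⊆ 𝓞 L` over `ℓ`, the prime `Q ∩ K` is ramified over `ℤ`. [folklore] -/
theorem not_isUnramifiedAt_under_of_dvd_discr (hL : finrank ℚ L = 6) (K : IntermediateField ℚ L)
    (hK : finrank ℚ K = 2) {ℓ : ℤ} (hℓ : Prime ℓ) (hℓK : ℓ ∣ discr K)
    (Q : Ideal (𝓞 L)) [Q.IsMaximal] [hQ : Q.LiesOver (Ideal.span {ℓ})] :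
    ¬ Algebra.IsUnramifiedAt ℤ (Q.under (𝓞 K)) := by
  haveI : IsGalois ℚ K := isGalois_of_quadratic hL K hK
  haveI : (Q.under (𝓞 K)).IsMaximal := Ideal.IsMaximal.under (𝓞 K) Q
  haveI : (Q.under (𝓞 K)).LiesOver (Ideal.span {ℓ}) := by
    rw [hQ.over, ← Ideal.under_under Q (B := 𝓞 K)]
    exact ⟨rfl⟩
  intro h
  exact ramificationIdx_ne_one_of_dvd_discr hℓ hℓK (Q.under (𝓞 K))
    (Ideal.ramificationIdx_eq_one_iff.mpr h)

/-- Every prime dividing the discriminant of a subfield `K` (here: the quadratic subfield of the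
Galois sextic `L`) divides `d_L`. [folklore] -/
theorem dvd_discr_of_dvd_discr_quadratic (hL : finrank ℚ L = 6) (K : IntermediateField ℚ L)
    (hK : finrank ℚ K = 2) {ℓ : ℕ} (hℓ : ℓ.Prime) (hℓK : (ℓ : ℤ) ∣ discr K) :
    (ℓ : ℤ) ∣ discr L := by
  classical
  have hℓ' : Prime (ℓ : ℤ) := Nat.prime_iff_prime_int.mp hℓ
  haveI : (Ideal.span {(ℓ : ℤ)}).IsMaximal :=
    ((Ideal.span_singleton_prime (by exact_mod_cast hℓ.ne_zero)).mpr hℓ').isMaximal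
      (by rw [Ne, Ideal.span_singleton_eq_bot]; exact_mod_cast hℓ.ne_zero)
  obtain ⟨Q, hQmax, hQover⟩ :=
    Ideal.exists_maximal_ideal_liesOver_of_isIntegral (S := 𝓞 L) (Ideal.span {(ℓ : ℤ)})
  have hram := not_isUnramifiedAt_under_of_dvd_discr hL K hK hℓ' hℓK Q
  have hI := card_inertia_of_ramified_quadratic hL K hK Q hram
  have heQ : Q.ramificationIdx ℤ ≠ 1 := by
    rw [← card_inertia_eq_ramificationIdx_int L (L ≃ₐ[ℚ] L) Q]
    omega
  by_contra hnd
  have hmem : ((ℓ : ℤ) : 𝓞 L) ∈ Q := by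
    have : (ℓ : ℤ) ∈ Q.under ℤ := by rw [← hQover.over]; exact Ideal.mem_span_singleton_self _
    rw [Ideal.mem_comap, eq_intCast] at this
    exact this
  haveI := (NumberField.not_dvd_discr_iff_forall_mem L (𝓞 L) hℓ').mp hnd Q hQmax.isPrime hmem
  exact heQ (Ideal.ramificationIdx_eq_one_of_isUnramifiedAt)

/-- **`p ∤ d_K`** for the quadratic subfield `K` of an ABELIAN sextic `L` with `d_L = −27p⁴`,
`p ≥ 5` prime (see the module docstring). [folklore] -/
theorem not_dvd_discr_quadratic (p : ℕ) (hp : p.Prime) (hp5 : 5 ≤ p) (hL : finrank ℚ L = 6)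
    (hab : ∀ σ τ : L ≃ₐ[ℚ] L, σ * τ = τ * σ) (hdisc : discr L = -(27 * (p : ℤ) ^ 4))
    (K : IntermediateField ℚ L) (hK : finrank ℚ K = 2) : ¬ ((p : ℤ) ∣ discr K) := by
  classical
  intro hpK
  have hp' : Prime (p : ℤ) := Nat.prime_iff_prime_int.mp hp
  have hG : Nat.card (L ≃ₐ[ℚ] L) = 6 := by rw [IsGalois.card_aut_eq_finrank, hL]
  have hKL : finrank K L = 3 := by
    have h := Module.finrank_mul_finrank ℚ K L
    rw [hK, hL] at h
    omega
  have hHK : Nat.card K.fixingSubgroup = 3 := by rw [IsGalois.card_fixingSubgroup_eq_finrank, hKL]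
  -- a maximal `Q ⊆ 𝓞 L` over `p`
  haveI hpmax : (Ideal.span {(p : ℤ)}).IsMaximal :=
    ((Ideal.span_singleton_prime (by exact_mod_cast hp.ne_zero)).mpr hp').isMaximal
      (by rw [Ne, Ideal.span_singleton_eq_bot]; exact_mod_cast hp.ne_zero)
  obtain ⟨Q, hQmax, hQover⟩ :=
    Ideal.exists_maximal_ideal_liesOver_of_isIntegral (S := 𝓞 L) (Ideal.span {(p : ℤ)})
  have hQunder : Q.under ℤ = Ideal.span {(p : ℤ)} := hQover.over.symm
  have hram := not_isUnramifiedAt_under_of_dvd_discr hL K hK hp' hpK Q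
  rcases card_inertia_of_ramified_quadratic hL K hK Q hram with h2 | h6
  · -- `#I(Q) = 2`: the fixed field `F'` of `I(Q)` is a Galois cubic unramified at `p`
    set I : Subgroup (L ≃ₐ[ℚ] L) := Q.inertia (L ≃ₐ[ℚ] L) with hIdef
    haveI hIn : I.Normal := ⟨fun n hn g => by rwa [hab g n, mul_inv_cancel_right]⟩
    set F' : IntermediateField ℚ L := IntermediateField.fixedField I with hF'def
    have hHF' : F'.fixingSubgroup = I := IntermediateField.fixingSubgroup_fixedField I
    haveI : IsGalois ℚ F' := IsGalois.of_fixedField_normal_subgroup (K := ℚ) (L := L) I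
    have hF'L : finrank F' L = 2 := by
      rw [hF'def, IntermediateField.finrank_fixedField_eq_card, h2]
    have hpF' : ¬ ((p : ℤ) ∣ discr F') := by
      intro hdvd
      haveI : (Q.under (𝓞 F')).IsMaximal := Ideal.IsMaximal.under (𝓞 F') Q
      haveI : (Q.under (𝓞 F')).LiesOver (Ideal.span {(p : ℤ)}) := by
        rw [← hQunder, ← Ideal.under_under Q (B := 𝓞 F')]
        exact ⟨rfl⟩
      have hne : (Q.under (𝓞 F')).ramificationIdx ℤ ≠ 1 :=
        ramificationIdx_ne_one_of_dvd_discr hp' hdvd (Q.under (𝓞 F'))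
      apply hne
      rw [Ideal.ramificationIdx_eq_one_iff, isUnramifiedAt_under_iff_inertia_le L F' Q, hHF', hIdef]
    -- `|d_L| ∣ |d_{F'}|² · |d_K|³`
    have hsep : ∀ s : L ≃ₐ[ℚ] L, s ≠ 1 →
        ∃ i ∈ (Finset.univ : Finset (Fin 2)), s ∉ ((![F', K] : Fin 2 → IntermediateField ℚ L) i).fixingSubgroup := by
      intro s hs
      by_contra hall
      push Not at hall
      have h0 : s ∈ F'.fixingSubgroup := by simpa using hall 0 (Finset.mem_univ _)
      have h1 : s ∈ K.fixingSubgroup := by simpa using hall 1 (Finset.mem_univ _)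
      rw [hHF'] at h0
      exact hs (eq_one_of_mem_of_card_two_three h2 hHK h0 h1)
    have hdvd := natAbs_discr_dvd_prod_pow_of_isGalois L Finset.univ
      (![F', K] : Fin 2 → IntermediateField ℚ L) hsep
    rw [Fin.prod_univ_two] at hdvd
    simp only [Matrix.cons_val_zero, Matrix.cons_val_one] at hdvd
    rw [hF'L, hKL] at hdvd
    -- `p⁴ ∣ |d_L|`
    have hp4 : p ^ 4 ∣ (discr L).natAbs := by
      rw [hdisc, Int.natAbs_neg, Int.natAbs_mul, Int.natAbs_pow, Int.natAbs_natCast]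
      exact Dvd.intro_left _ rfl
    have hpa : ¬ p ∣ (discr F').natAbs := fun h => hpF' (Int.ofNat_dvd_left.mpr h)
    have hp2K : ¬ (p : ℤ) ^ 2 ∣ discr K := by
      intro h
      have h2abs := natAbs_eq_two_of_sq_dvd_of_isFundamental hp'
        (Quadratic.isFundamentalDiscriminant_discr hK) h
      rw [Int.natAbs_natCast] at h2abs
      omega
    exact not_pow_four_dvd hp hpa hp2K (hp4.trans hdvd)
  · -- `#I(Q) = 6`: `e(Q|p) = 6`, so `p⁵ ∣ d_L = -27 p⁴`
    haveI := hQmax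
    have he : Q.ramificationIdx ℤ = 6 := by
      rw [← card_inertia_eq_ramificationIdx_int L (L ≃ₐ[ℚ] L) Q]; exact h6
    have h5 := pow_ramificationIdx_sub_one_dvd_discr L Q (p := (p : ℤ)) hQunder
    rw [he, hdisc, dvd_neg] at h5
    norm_num at h5
    have hnat : p ^ 5 ∣ 27 * p ^ 4 := by exact_mod_cast h5
    have hp0 : 0 < p := hp.pos
    have : p ∣ 27 := by
      have h := Nat.dvd_div_of_mul_dvd (show p ^ 4 * p ∣ 27 * p ^ 4 by
        simpa [pow_succ] using hnat)
      rwa [Nat.mul_div_cancel _ (pow_pos hp0 4)] at h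
    have h3 : p ∣ 3 ^ 3 := by norm_num; exact this
    have := (Nat.prime_dvd_prime_iff_eq hp Nat.prime_three).mp (hp.dvd_of_dvd_pow h3)
    omega

/-- **The quadratic subfield of an abelian sextic field of discriminant `−27p⁴` (`p ≥ 5` prime)
has discriminant `−3`**, i.e. is `ℚ(√−3) = ℚ(ω)` (in the application `L = K_p(ω)`, the compositum
of the cyclic cubic field of conductor `p` with `ℚ(ω)`). See the module docstring for the proof.
[folklore] -/
theorem discr_quadratic_eq_neg_three (p : ℕ) (hp : p.Prime) (hp5 : 5 ≤ p)
    (hL : finrank ℚ L = 6) (hab : ∀ σ τ : L ≃ₐ[ℚ] L, σ * τ = τ * σ)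
    (hdisc : discr L = -(27 * (p : ℤ) ^ 4)) (K : IntermediateField ℚ L) (hK : finrank ℚ K = 2) :
    discr K = -3 := by
  classical
  have hpK := not_dvd_discr_quadratic p hp hp5 hL hab hdisc K hK
  -- prime divisors of `d_K` lie in `{3}`
  have h3only : ∀ q : ℕ, q.Prime → q ∣ (discr K).natAbs → q = 3 := by
    intro q hq hqd
    have hqK : (q : ℤ) ∣ discr K := Int.ofNat_dvd_left.mpr hqd
    have hqL : (q : ℤ) ∣ discr L := dvd_discr_of_dvd_discr_quadratic hL K hK hq hqK
    rw [hdisc, dvd_neg] at hqL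
    have hqL' : q ∣ 27 * p ^ 4 := by exact_mod_cast Int.ofNat_dvd_left.mp hqL
    rcases eq_three_or_eq_of_prime_dvd hp hq hqL' with h3 | hqp
    · exact h3
    · exact absurd (hqp ▸ hqK) hpK
  have hd0 : (discr K).natAbs ≠ 0 := Int.natAbs_ne_zero.mpr (discr_ne_zero K)
  obtain ⟨m, hpow⟩ : ∃ m : ℕ, (discr K).natAbs = 3 ^ m :=
    ⟨_, Nat.eq_prime_pow_of_unique_prime_dvd hd0 (fun hq hqd => h3only _ hq hqd)⟩
  rcases Quadratic.isFundamentalDiscriminant_discr hK with ⟨h1, hsq, hne1⟩ | ⟨h4, -, -⟩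
  · -- odd fundamental discriminant: squarefree, `≡ 1 (mod 4)`
    have hsqN : Squarefree (discr K).natAbs := Int.squarefree_natAbs.mpr hsq
    have habs : (discr K).natAbs = 1 ∨ (discr K).natAbs = 3 := by
      rcases m with _ | _ | m
      · left; rw [hpow, pow_zero]
      · right; rw [hpow, pow_one]
      · exfalso
        have h9 : 3 * 3 ∣ (discr K).natAbs := ⟨3 ^ m, by rw [hpow]; ring⟩
        have := hsqN 3 h9
        norm_num at this
    rcases habs with ha | ha
    · rcases Int.natAbs_eq_iff.mp ha with h | h <;> simp only [Nat.cast_one] at h <;> omega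
    · rcases Int.natAbs_eq_iff.mp ha with h | h <;> simp only [Nat.cast_ofNat] at h <;> omega
  · -- even discriminant: `2 ∣ d_L = -27 p⁴`, impossible for `p` odd
    exfalso
    have h2K : ((2 : ℕ) : ℤ) ∣ discr K := (show ((2 : ℕ) : ℤ) ∣ 4 by norm_num).trans h4
    have h2L := dvd_discr_of_dvd_discr_quadratic hL K hK Nat.prime_two h2K
    rw [hdisc, dvd_neg] at h2L
    have h2L' : 2 ∣ 27 * p ^ 4 := by exact_mod_cast Int.ofNat_dvd_left.mp h2L
    rcases eq_three_or_eq_of_prime_dvd hp Nat.prime_two h2L' with h | h <;> omega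

end Main

end Summit.QuantumAdvantage.QuantumAdvantage.Theorems.SexticEscapeCount

end
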